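import Mathlib.Analysis.Complex.Basic
import Mathlib.Analysis.Normed.Module.FiniteDimension
import Literature.NumberTheory.Automorphic.CongruenceHeckeMultiplicativity
import Literature.NumberTheory.Automorphic.CartanDecompositionGLnPowers
import Literature.NumberTheory.Automorphic.MatrixCoefficients
import HarnessLib

/-!
# Exponential growth of spherical matrix coefficients of admissible representations of `GL_n(F)`

Topic `NumberTheory/Automorphic`; theorems only (no definition, no named fact). Let `F` be a
non-archimedean local field, `K = GL_n(𝒪) = glInt n F`, `ϖ` a uniformizing element,
`Δ_m = glIntDet n ϖ m` the integral matrices with `|det| = |ϖ|^m`, and `ρ` an **admissible**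
representation of `GL_n(F)` on a complex vector space `V` (`Representation.IsAdmissible`: smooth,
with finite-dimensional fixed vectors under compact open subgroups). For a `K`-fixed vector `v`
and a `K`-invariant linear form `φ` (e.g. `φ ∈ (V^*)^K`), the bi-`K`-invariant coefficient
`f(g) = φ(ρ(g) v)` satisfies

`‖f(y)‖ ≤ C · M^m` for all `y ∈ Δ_m`, all `m ≥ 0`

(`exists_norm_matrixCoeff_le_of_mem_glIntDet`, and `…_of_mem_fixedPoints_dual` for
`φ ∈ ρ.dual.fixedPoints K`). This is the growth input that makes the spherical Godement–Jacquet
zeta integral `Z(1_{M_n(𝒪)}, s, f) = ∑_m q^{-ms} ∑_{yK ⊆ Δ_m} f(y)` absolutely convergent for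
`re s ≫ 0` for *every* admissible spherical representation (Godement–Jacquet (1972), Lemma 6.10;
the tree's `GodementJacquetLemma610Bounded` treats bounded `f`), without Macdonald's formula for
the zonal spherical functions.

## Proof (elementary; Hecke operators of the first congruence subgroup)

Let `K₁ = 1 + 𝓂 M_n(𝒪)` (`proUnipotentGL n F c` with `c` constant), compact open, so `V^{K₁}` is
finite-dimensional and contains `v`. By the Cartan decomposition (`CartanDecompositionGLnPowers`)
`y = k₁⁻¹ ϖ^a k₂⁻¹` with `a` antitone, `∑ a_i = m`, so `f(y) = φ(ρ(ϖ^a) v)`; by the averaging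
formula `deg(ϖ^a) φ(ρ(ϖ^a) v) = φ([K₁ ϖ^a K₁] v)`; by the multiplicativity of the operators
`[K₁ ϖ^a K₁]` on the dominant cone (`CongruenceHeckeMultiplicativity`, from the triangular
factorisation of `K₁`, `CongruenceSubgroupFactorization`)
`N [K₁ ϖ^a K₁] v = A_{ε_1} ⋯ A_{ε_ℓ} v` with `N ≥ 1`, `ℓ ≤ m` and finitely many operators
`A_ε = [K₁ ϖ^ε K₁]` preserving `V^{K₁}`; and a word of length `ℓ` in finitely many endomorphisms
of a finite-dimensional complex space grows at most like `M^ℓ` (`exists_norm_apply_prod_map_le`,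
operator norms after a choice of coordinates `V^{K₁} ≃ ℂ^d`). Compare Casselman (1995), §4
(asymptotics of coefficients via Jacquet modules), of which this is the crude half.

## References

* R. Godement, H. Jacquet, *Zeta functions of simple algebras*, LNM 260 (1972), Lemma 6.10
  [GodementJacquet1972]; H. Jacquet, Corvallis (1979), Part 2, (1.4) [JacquetCorvallis1979].
* W. Casselman, *Introduction to the theory of admissible representations of 𝔭-adic reductive
  groups* (1995 notes), Prop. 1.4.4, Lemma 4.1.5, §4.2.
* P. Cartier, *Representations of 𝔭-adic groups: a survey*, Corvallis (1979), §IV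
  [CartierCorvallis1979].
-/

noncomputable section

open MulAction ValuativeRel Matrix

namespace Literature.NumberTheory.Automorphic

/-! ### Words of endomorphisms preserving a finite-dimensional subspace -/

section Words

variable {V : Type*} [AddCommGroup V] [Module ℂ V]

/-- A word in endomorphisms preserving `W`, restricted to `W`, is the restriction of the word.
[folklore] -/
theorem subtype_prod_map_restrict_apply {ι : Type*} (W : Submodule ℂ V)
    (T : ι → Module.End ℂ V) (hT : ∀ i, ∀ x ∈ W, T i x ∈ W) (w : List ι) (x : W) :
    (((w.map fun i => (T i).restrict (hT i)).prod x : W) : V) = (w.map T).prod (x : V) := by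
  induction w with
  | nil => simp
  | cons i w ih =>
    rw [List.map_cons, List.prod_cons, Module.End.mul_apply, LinearMap.coe_restrict_apply, ih,
      List.map_cons, List.prod_cons, Module.End.mul_apply]

/-- **Words in finitely many endomorphisms of a finite-dimensional space grow at most
exponentially.** If `W ≤ V` is finite-dimensional over `ℂ`, the endomorphisms `T_i` preserve `W`,
`S` is a finite set of indices, `φ` a linear form and `v ∈ W`, then there are `C ≥ 0`, `M ≥ 1`
with `‖φ(T_{i_1} ⋯ T_{i_ℓ} v)‖ ≤ C M^ℓ` for every word `i_1 ⋯ i_ℓ` in `S` (choose coordinates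
`W ≃ ℂ^d`; `M = 1 + ∑_{i ∈ S} ‖T_i|_W‖`, `C = ‖φ|_W‖ ‖v‖` in operator norms). [folklore] -/
theorem exists_norm_apply_prod_map_le {ι : Type*} (W : Submodule ℂ V) [Module.Finite ℂ W]
    (T : ι → Module.End ℂ V) (hT : ∀ i, ∀ x ∈ W, T i x ∈ W) (S : Finset ι)
    (φ : Module.Dual ℂ V) {v : V} (hv : v ∈ W) :
    ∃ C M : ℝ, 0 ≤ C ∧ 1 ≤ M ∧ ∀ w : List ι, (∀ i ∈ w, i ∈ S) →
      ‖φ ((w.map T).prod v)‖ ≤ C * M ^ w.length := by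
  classical
  -- coordinates `e : W ≃ ℂ^d`, transported operators `A i` and form `ψ`
  set e : W ≃ₗ[ℂ] (Fin (Module.finrank ℂ W) → ℂ) := (Module.finBasis ℂ W).equivFun with he
  set A : ι → ((Fin (Module.finrank ℂ W) → ℂ) →L[ℂ] (Fin (Module.finrank ℂ W) → ℂ)) := fun i =>
    LinearMap.toContinuousLinearMap
      (e.toLinearMap ∘ₗ (T i).restrict (hT i) ∘ₗ e.symm.toLinearMap) with hA
  set ψ : (Fin (Module.finrank ℂ W) → ℂ) →L[ℂ] ℂ :=
    LinearMap.toContinuousLinearMap (φ ∘ₗ W.subtype ∘ₗ e.symm.toLinearMap) with hψ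
  set M : ℝ := 1 + ∑ i ∈ S, ‖A i‖ with hM
  have hM1 : 1 ≤ M := le_add_of_nonneg_right (Finset.sum_nonneg fun i _ => norm_nonneg _)
  have hAM : ∀ i ∈ S, ‖A i‖ ≤ M := fun i hi =>
    (Finset.single_le_sum (fun j _ => norm_nonneg (A j)) hi).trans
      (le_add_of_nonneg_left zero_le_one)
  have hAe : ∀ i (x : W), e ((T i).restrict (hT i) x) = A i (e x) := by
    intro i x
    simp [hA, LinearMap.coe_toContinuousLinearMap']
  -- the key estimate, inside `W`
  have key : ∀ w : List ι, (∀ i ∈ w, i ∈ S) → ∀ x : W,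
      ‖e ((w.map fun i => (T i).restrict (hT i)).prod x)‖ ≤ M ^ w.length * ‖e x‖ := by
    intro w
    induction w with
    | nil =>
      intro _ x
      simp
    | cons i w ih =>
      intro hw x
      have hi : i ∈ S := hw i List.mem_cons_self
      have hw' : ∀ j ∈ w, j ∈ S := fun j hj => hw j (List.mem_cons_of_mem i hj)
      rw [List.map_cons, List.prod_cons, Module.End.mul_apply, List.length_cons, pow_succ, hAe]
      calc ‖A i (e ((w.map fun i => (T i).restrict (hT i)).prod x))‖
          ≤ ‖A i‖ * ‖e ((w.map fun i => (T i).restrict (hT i)).prod x)‖ := (A i).le_opNorm _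
        _ ≤ M * (M ^ w.length * ‖e x‖) :=
          mul_le_mul (hAM i hi) (ih hw' x) (norm_nonneg _) (zero_le_one.trans hM1)
        _ = M ^ w.length * M * ‖e x‖ := by ring
  refine ⟨‖ψ‖ * ‖e ⟨v, hv⟩‖, M, mul_nonneg (norm_nonneg _) (norm_nonneg _), hM1, fun w hw => ?_⟩
  have hφ : φ ((w.map T).prod v) =
      ψ (e ((w.map fun i => (T i).restrict (hT i)).prod ⟨v, hv⟩)) := by
    rw [← subtype_prod_map_restrict_apply W T hT w ⟨v, hv⟩]
    simp [hψ, LinearMap.coe_toContinuousLinearMap']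
  rw [hφ]
  calc ‖ψ (e ((w.map fun i => (T i).restrict (hT i)).prod ⟨v, hv⟩))‖
      ≤ ‖ψ‖ * ‖e ((w.map fun i => (T i).restrict (hT i)).prod ⟨v, hv⟩)‖ := ψ.le_opNorm _
    _ ≤ ‖ψ‖ * (M ^ w.length * ‖e ⟨v, hv⟩‖) :=
      mul_le_mul_of_nonneg_left (key w hw _) (norm_nonneg _)
    _ = ‖ψ‖ * ‖e ⟨v, hv⟩‖ * M ^ w.length := by ring

end Words

/-! ### Invariant linear forms -/

section Dual

variable {k G V : Type*} [CommRing k] [Group G] [AddCommGroup V] [Module k V]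
  (ρ : Representation k G V)

/-- A linear form fixed by `K` under the dual action (`φ ∈ (V^*)^K`, i.e. `φ ∘ ρ(g⁻¹) = φ` for
`g ∈ K`) is `K`-invariant: `φ(ρ(g) w) = φ(w)`. [folklore] -/
theorem apply_apply_eq_of_mem_fixedPoints_dual {K : Subgroup G} {φ : Module.Dual k V}
    (hφ : φ ∈ ρ.dual.fixedPoints K) {g : G} (hg : g ∈ K) (w : V) : φ (ρ g w) = φ w := by
  have h := (ρ.dual.mem_fixedPoints K φ).1 hφ g⁻¹ (K.inv_mem hg)
  have h' := LinearMap.congr_fun h w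
  rw [Representation.dual_apply, Module.Dual.transpose_apply, inv_inv, LinearMap.comp_apply] at h'
  exact h'

end Dual

/-! ### The growth bound -/

section Growth

variable {F : Type*} [Field F] [ValuativeRel F] [TopologicalSpace F] [IsNonarchimedeanLocalField F]
  {n : ℕ} {V : Type*} [AddCommGroup V] [Module ℂ V] (ρ : Representation ℂ (GL (Fin n) F) V)

/-- **Exponential growth of spherical coefficients of admissible representations.** Let `ρ` be an
admissible representation of `GL_n(F)` (`F` a non-archimedean local field) on a complex vector
space, `v ∈ V^K` (`K = GL_n(𝒪)`), `φ` a `K`-invariant linear form and `ϖ` a uniformizing element.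
Then there are `C ≥ 0`, `M ≥ 1` such that `‖φ(ρ(y) v)‖ ≤ C M^m` for every `m` and every
`y ∈ Δ_m = {y integral, |det y| = |ϖ|^m}`. Proof: `y ∈ K ϖ^a K` with `a` antitone, `|a| = m`
(Cartan), `deg · φ(ρ(ϖ^a) v) = φ([K₁ ϖ^a K₁] v)` (averaging over `K₁ = 1 + 𝓂 M_n(𝒪)`),
`N [K₁ ϖ^a K₁] v` is a word of length `≤ m` in the finitely many operators `[K₁ ϖ^ε K₁]`, `ε`
a `0/1`-vector, acting on the finite-dimensional `V^{K₁}` (`exists_smul_heckeOperator_piPowGL_eq_prod`),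
and such words grow at most exponentially (`exists_norm_apply_prod_map_le`). This replaces the
asymptotics of zonal spherical functions (Macdonald; Casselman (1995), §4) in the convergence of
the unramified Godement–Jacquet zeta integral (Godement–Jacquet (1972), Lemma 6.10).
[folklore] -/
theorem exists_norm_matrixCoeff_le_of_mem_glIntDet (hρ : ρ.IsAdmissible) {ϖ : F}
    (hϖ : IsUniformizingElement ϖ) {v : V} (hv : v ∈ ρ.fixedPoints (glInt n F))
    {φ : Module.Dual ℂ V} (hφ : ∀ g ∈ glInt n F, ∀ w : V, φ (ρ g w) = φ w) :
    ∃ C M : ℝ, 0 ≤ C ∧ 1 ≤ M ∧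
      ∀ m : ℕ, ∀ y ∈ glIntDet n ϖ m, ‖ρ.matrixCoeff φ v y‖ ≤ C * M ^ m := by
  classical
  -- the first congruence subgroup `K₁ = proUnipotentGL n F c₀`, `c₀` constant
  set c₀ : Fin n → Fin 1 := fun _ => 0 with hc₀def
  have hc₀ : ∀ i j, c₀ i = c₀ j := fun _ _ => rfl
  have hJK : proUnipotentGL n F c₀ ≤ glInt n F := proUnipotentGL_le_glInt n F c₀
  haveI : IsHeckeTriple (⊤ : Submonoid (GL (Fin n) F)) (proUnipotentGL n F c₀)
      (proUnipotentGL n F c₀) :=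
    isHeckeTriple_top_of_isCompact_isOpen _ (isCompact_proUnipotentGL n F c₀)
      (isOpen_proUnipotentGL n F c₀)
  have hfin : ∀ g : GL (Fin n) F,
      (orbit (proUnipotentGL n F c₀) (g : GL (Fin n) F ⧸ proUnipotentGL n F c₀)).Finite :=
    fun g => finite_orbit_quotient _ g
  -- `V^{K₁}` is finite-dimensional and contains `v`
  haveI : Module.Finite ℂ (ρ.fixedPoints (proUnipotentGL n F c₀)) :=
    hρ.finite_fixedPoints ⟨proUnipotentGL n F c₀, isOpen_proUnipotentGL n F c₀⟩
      (isCompact_proUnipotentGL n F c₀)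
  have hvJ : v ∈ ρ.fixedPoints (proUnipotentGL n F c₀) := ρ.fixedPoints_antitone hJK hv
  have hφJ : ∀ g ∈ proUnipotentGL n F c₀, ∀ w : V, φ (ρ g w) = φ w :=
    fun g hg w => hφ g (hJK hg) w
  -- the letters `[K₁ ϖ^ε K₁]` preserve `V^{K₁}`; the finite-dimensional bound
  have hTW : ∀ ε : Fin n → ℕ, ∀ x ∈ ρ.fixedPoints (proUnipotentGL n F c₀),
      heckeOperator ρ (proUnipotentGL n F c₀) (piPowGL hϖ.ne_zero ε) x ∈
        ρ.fixedPoints (proUnipotentGL n F c₀) :=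
    fun ε x hx => heckeOperator_apply_mem_fixedPoints ρ _ _ hx (hfin _)
  obtain ⟨C, M, hC, hM, hbound⟩ := exists_norm_apply_prod_map_le
    (ρ.fixedPoints (proUnipotentGL n F c₀))
    (fun ε : Fin n → ℕ => heckeOperator ρ (proUnipotentGL n F c₀) (piPowGL hϖ.ne_zero ε)) hTW
    (Fintype.piFinset fun _ : Fin n => Finset.range 2) φ hvJ
  refine ⟨C, M, hC, hM, fun m y hy => ?_⟩
  -- Cartan: `k₁ y k₂ = ϖ^a`, so `f(y) = φ(ρ(ϖ^a) v)`
  obtain ⟨k₁, hk₁, k₂, hk₂, a, ha, hsum, hya⟩ :=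
    exists_glInt_mul_mul_eq_piPowGL_of_mem_glIntDet hϖ hy
  have hcoeff : ρ.matrixCoeff φ v y = φ (ρ (piPowGL hϖ.ne_zero a) v) := by
    have ey : y = k₁⁻¹ * piPowGL hϖ.ne_zero a * k₂⁻¹ := by rw [← hya]; group
    change φ (ρ y v) = _
    rw [ey, map_mul, map_mul, Module.End.mul_apply, Module.End.mul_apply,
      (ρ.mem_fixedPoints _ v).1 hv _ (Subgroup.inv_mem _ hk₂), hφ _ (Subgroup.inv_mem _ hk₁)]
  -- words: `N [K₁ ϖ^a K₁] v = A_{ε_1} ⋯ A_{ε_ℓ} v`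
  obtain ⟨N, w, hN, hwlen, hw, hword⟩ := exists_smul_heckeOperator_piPowGL_eq_prod ρ hc₀
    hϖ.ne_zero hϖ.valuation_le_one hfin m a ha hsum.le
  have hwS : ∀ ε ∈ w, ε ∈ Fintype.piFinset fun _ : Fin n => Finset.range 2 := by
    intro ε hε
    rw [Fintype.mem_piFinset]
    intro i
    exact Finset.mem_range.2 (Nat.lt_succ_of_le ((hw ε hε).2 i))
  -- averaging: `φ([K₁ ϖ^a K₁] v) = deg • φ(ρ(ϖ^a) v)` with `deg ≥ 1`
  have havg := map_heckeOperator_eq_card_smul ρ (proUnipotentGL n F c₀) φ.toAddMonoidHom hφJ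
    (piPowGL hϖ.ne_zero a) (hfin _) hvJ
  simp only [LinearMap.toAddMonoidHom_coe, nsmul_eq_mul] at havg
  have hdeg1 : 1 ≤ (hfin (piPowGL hϖ.ne_zero a)).toFinset.card := by
    rw [Nat.one_le_iff_ne_zero, Ne, Finset.card_eq_zero, ← Ne, ← Finset.nonempty_iff_ne_empty]
    exact ⟨_, (Set.Finite.mem_toFinset _).2 (mem_orbit_self _)⟩
  -- combine
  have hkey : ((N * (hfin (piPowGL hϖ.ne_zero a)).toFinset.card : ℕ) : ℂ) *
      φ (ρ (piPowGL hϖ.ne_zero a) v) =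
      φ ((w.map fun ε : Fin n → ℕ =>
        heckeOperator ρ (proUnipotentGL n F c₀) (piPowGL hϖ.ne_zero ε)).prod v) := by
    rw [← hword v hvJ, map_smul, smul_eq_mul, Nat.cast_mul, mul_assoc, havg]
  have hNd : (1 : ℝ) ≤ ((N * (hfin (piPowGL hϖ.ne_zero a)).toFinset.card : ℕ) : ℝ) := by
    have h := Nat.mul_le_mul hN hdeg1
    rw [one_mul] at h
    exact_mod_cast h
  calc ‖ρ.matrixCoeff φ v y‖ = ‖φ (ρ (piPowGL hϖ.ne_zero a) v)‖ := by rw [hcoeff]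
    _ ≤ ((N * (hfin (piPowGL hϖ.ne_zero a)).toFinset.card : ℕ) : ℝ) *
          ‖φ (ρ (piPowGL hϖ.ne_zero a) v)‖ := le_mul_of_one_le_left (norm_nonneg _) hNd
    _ = ‖φ ((w.map fun ε : Fin n → ℕ =>
          heckeOperator ρ (proUnipotentGL n F c₀) (piPowGL hϖ.ne_zero ε)).prod v)‖ := by
        rw [← hkey, norm_mul, Complex.norm_natCast]
    _ ≤ C * M ^ w.length := hbound w hwS
    _ ≤ C * M ^ m := mul_le_mul_of_nonneg_left (pow_le_pow_right₀ hM hwlen) hC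

/-- **Exponential growth of spherical coefficients**, for `φ ∈ (V^*)^K`
(`ρ.dual.fixedPoints (glInt n F)`, the hypothesis of `GodementJacquet1972_lemma610`): there are
`C ≥ 0`, `M ≥ 1` with `‖φ(ρ(y) v)‖ ≤ C M^m` on `Δ_m` (`exists_norm_matrixCoeff_le_of_mem_glIntDet`).
[folklore] -/
theorem exists_norm_matrixCoeff_le_of_mem_glIntDet_of_mem_fixedPoints_dual (hρ : ρ.IsAdmissible)
    {ϖ : F} (hϖ : IsUniformizingElement ϖ) {v : V} (hv : v ∈ ρ.fixedPoints (glInt n F))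
    {φ : Module.Dual ℂ V} (hφ : φ ∈ ρ.dual.fixedPoints (glInt n F)) :
    ∃ C M : ℝ, 0 ≤ C ∧ 1 ≤ M ∧
      ∀ m : ℕ, ∀ y ∈ glIntDet n ϖ m, ‖ρ.matrixCoeff φ v y‖ ≤ C * M ^ m :=
  exists_norm_matrixCoeff_le_of_mem_glIntDet ρ hρ hϖ hv
    fun _ hg w => apply_apply_eq_of_mem_fixedPoints_dual ρ hφ hg w

end Growth

end Literature.NumberTheory.Automorphic
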